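import Literature.AnabelianGeometry.EtaleTheta.TemperedFrobenioidGenuineWeakPiNat
import Literature.AnabelianGeometry.EtaleTheta.RealifiedDivisorMonoidsOfRlfQWeak
import HarnessLib

/-!
# [EtTh] Def. 3.6 (ii), monoid type `Λ = ℚ`: a tempered Frobenioid over the WEAK constructed Def. 3.6 (i) data at
# `Φ₀ = ∏_ℕ ℤ_{≥0}` (infinitely many special-fibre components) — non-vacuity witness

S. Mochizuki, *The étale theta function and its Frobenioid-theoretic manifestations*, Publ. RIMS **45** (2009),
Def. 3.6 (i)/(ii) pp.76–77 ("`Λ ∈ {ℤ, ℚ, ℝ}` … `B₀^ℚ := B₀^pf`, `F₀^ℚ := F₀^pf`")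
[cite: MochizukiEtTh2009, Def 3.6 p.77].

abc-iut cell, layer L2, seat abc-iut-L2-d2 (gen 5), row «(H)-ℚ + COR38-NV@WeakPiNatQ», the `Λ = ℚ` companion of this
lineage's `TemperedFrobenioidGenuineWeakPiNat.lean` (p441924, `Λ = ℤ`) and `TemperedFrobenioidGenuineWeakPiNatR.lean`
(p443334, `Λ = ℝ`) — model-construction file (post-freeze class (b): new path, nothing frozen edited).
Over abc-iut-L6-t12's `ofRlfQWeak WeakPiNat.divisorMonoids _` (p425661: `B₀^ℚ = B₀^pf = (ϖ^ℤ)^pf`, `F₀^ℚ = F₀^pf`,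
`B₀^ℚ → (Φ₀^ℝ)^gp` the perfection of `B₀ → Φ₀^gp → (Φ₀^ℝ)^gp`) the SAME divisor monoid `Φ := im(Φ₀^pf → Φ₀^rlf)` as at
`Λ = ℤ` satisfies Def. 3.6 (ii): `Φ^{ℝ-log}`, `Φ₀ → Φ₀^ℝ`, `ℝ·Φ₀^cnst` and the (non-)cuspidal parts of `ofRlfQWeak`
coincide with those of `ofRlfZWeak` (`rfl`), so group-saturation, weak perf-factoriality, divisoriality and (a)
"`Φ^{bs-fld} = ι(⟨d⟩^pf)` monoprime" are the `Λ = ℤ` theorems verbatim; (b) is witnessed by the constant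
`ϖ ∈ F₀(Y) ⊆ F₀(Y)^pf = F₀^ℚ(Y)`, whose image in `(Φ₀^ℝ)^gp` is `ι(d)/1` (`divQWeak_of`), `ι(d) ≠ 1`:

* `WeakPiNat.realifiedQ := ofRlfQWeak divisorMonoids _`;
* `WeakPiNat.genuineTemperedFrobenioidQ R S : TemperedFrobenioid realifiedQ (Discrete PUnit) (treeCatVocab …)`;
* `nonempty_temperedFrobenioid_weakQ_piNat` — with p441924 / p443334, [EtTh] Def. 3.6 (ii) over the weak vocabulary
  is INHABITED at `Φ₀ = ∏_ℕ ℤ_{≥0}` for ALL THREE monoid types `Λ ∈ {ℤ, ℚ, ℝ}`.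

HONEST LABEL: GENUINE weak/realification/[FrdI] vocabularies; DEGENERATE geometry (one object, no cusps, constant
functions only); an instantiation witness, NOT the tempered Frobenioid of monoid type `ℚ` of a curve.  No statement
of the paper is asserted; nothing here bears on [IUTchIII] Cor. 3.12.  Typed ≠ proved.
-/

noncomputable section

namespace Literature.AnabelianGeometry.EtaleTheta

open CategoryTheory Opposite Literature.AlgebraicGeometry.Frobenioids

namespace WeakPiNat

/-- The Def. 3.6 (i) data for `Λ = ℚ` CONSTRUCTED over the weak vocabulary (abc-iut-L6-t12's `ofRlfQWeak`) at the
datum `Φ₀ = ∏_ℕ ℤ_{≥0}`, `B₀ = ϖ^ℤ`: `Φ₀^ℝ = (∏_ℕ ℤ_{≥0})^rlf`, `B₀^ℚ = (ϖ^ℤ)^pf`, `F₀^ℚ = F₀^pf`.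
[cite: MochizukiEtTh2009, Def 3.6 p.76] -/
abbrev realifiedQ : RealifiedDivisorMonoids (D₀ := Discrete PUnit.{1}) treeMonoidVocabWeak.{0} :=
  RealifiedDivisorMonoids.ofRlfQWeak WeakPiNat.divisorMonoids isPerfFactorialCof_Φ₀

/-- `ϖ ∈ F₀^ℚ(Y) = F₀(Y)^pf` (the image of `ϖ ∈ F₀(Y) = B₀(Y)` in the perfection).
[cite: MochizukiEtTh2009, Def 3.6 p.76] -/
theorem of_varpi_mem_FΛQ (Y : (Discrete PUnit.{1})ᵒᵖ) :
    (Perfection.of _ (Multiplicative.ofAdd (1 : ℤ)) : WeakPiNat.realifiedQ.BΛ.obj Y) ∈ WeakPiNat.realifiedQ.FΛ Y :=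
  ⟨Perfection.of _ ⟨Multiplicative.ofAdd (1 : ℤ), Submonoid.mem_top _⟩, rfl⟩

/-- The image of `ϖ ∈ B₀^ℚ(Y)` in `(Φ₀^ℝ)^gp(Y)` is the class of `ι(d)` (`divQWeak_of`: on `B₀(Y)` the `Λ = ℚ` divisor
map is the `Λ = ℤ` one, and `div₀(ϖ) = [d]`). [cite: MochizukiEtTh2009, Def 3.6 p.76] -/
theorem divΛQ_of_varpi (Y : (Discrete PUnit.{1})ᵒᵖ) :
    WeakPiNat.realifiedQ.divΛ Y (Perfection.of _ (Multiplicative.ofAdd (1 : ℤ))) =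
      Algebra.GrothendieckGroup.of ((isPerfFactorialCof_Φ₀ Y).weak.toRealification (Perfection.of _ diag)) := by
  have h1 : WeakPiNat.realifiedQ.divΛ Y (Perfection.of _ (Multiplicative.ofAdd (1 : ℤ))) =
      (RealifiedDivisorMonoids.ofRlfZWeak WeakPiNat.divisorMonoids isPerfFactorialCof_Φ₀).divΛ Y
        (Multiplicative.ofAdd (1 : ℤ)) :=
    RealifiedDivisorMonoids.divQWeak_of _ _ Y _
  rw [h1, RealifiedDivisorMonoids.ofRlfZWeak_divΛ_apply]
  change EtaleTheta.gpMap _ (divHom (Multiplicative.ofAdd (1 : ℤ))) = _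
  rw [divHom_ofAdd_one, EtaleTheta.gpMap_of]
  rfl

variable (R S : ((Discrete PUnit.{1})ᵒᵖ ⥤ CommMonCat.{0}) → Prop)

/-- **Def. 3.6 (ii) data of monoid type `ℚ` over the WEAK vocabulary at infinitely many special-fibre components**:
the tempered Frobenioid structure on `(D := Discrete PUnit → D₀, Φ := im(Φ₀^pf → Φ₀^rlf))` over
`ofRlfQWeak WeakPiNat.divisorMonoids _` and the genuine category vocabulary `treeCatVocab` — the `Λ = ℤ` proofs of
`genuineTemperedFrobenioid` verbatim for every clause but (b), which is witnessed by `ϖ ∈ F₀^ℚ` with image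
`ι(d)/1` in `(Φ₀^ℝ)^gp`, `ι(d) ≠ 1`. [cite: MochizukiEtTh2009, Def 3.6 p.77] -/
def genuineTemperedFrobenioidQ :
    TemperedFrobenioid WeakPiNat.realifiedQ (Discrete PUnit.{1}) (treeCatVocab (Discrete PUnit.{1}) R S) where
  isConnected := Toy.temperedFrobenioid.isConnected
  isTotallyEpimorphic := Toy.temperedFrobenioid.isTotallyEpimorphic
  base := 𝟭 _
  Φ := genuineΦ
  isGroupSaturated A := PfImageWeak.isGroupSaturated_mrange_toRealification (isPerfFactorialCof_Φ₀ A).weak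
  isPerfFactorial A := PfImageWeak.isPerfFactorialCof_mrange_toRealification (isPerfFactorialCof_Φ₀ A)
  isDivisorialOn := by
    rw [treeCatVocab_isDivisorialOn]
    exact ⟨Cor38Toy.isMonoidOn_of_punit _,
      fun A => PfImageWeak.isDivisorial_mrange_toRealification (isPerfFactorialCof_Φ₀ (op A))⟩
  isMonoprime_bsFld A := isMonoprime_bsFld A
  exists_FΛ_div_ne A :=
    ⟨Perfection.of _ (Multiplicative.ofAdd (1 : ℤ)), of_varpi_mem_FΛQ _,
      (isPerfFactorialCof_Φ₀ A).weak.toRealification (Perfection.of _ diag), ⟨_, rfl⟩, 1, one_mem _,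
      toRealification_of_diag_ne_one A, by rw [divΛQ_of_varpi, map_one, div_one]; rfl⟩

/-- `Φ` of the `Λ = ℚ` witness is `pfImage`. [cite: MochizukiEtTh2009, Def 3.6 p.77] -/
@[simp] theorem genuineTemperedFrobenioidQ_Φ_carrier (A : (Discrete PUnit.{1})ᵒᵖ) :
    (genuineTemperedFrobenioidQ R S).Φ.carrier A = pfImage A := rfl

/-- The base functor of the `Λ = ℚ` witness is the identity. [cite: MochizukiEtTh2009, Def 3.6 p.77] -/
@[simp] theorem genuineTemperedFrobenioidQ_base : (genuineTemperedFrobenioidQ R S).base = 𝟭 _ := rfl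

/-- **Def. 3.6 (ii) of monoid type `ℚ` over the WEAK vocabulary is INHABITED at `Φ₀ = ∏_ℕ ℤ_{≥0}`** — with this
lineage's `nonempty_temperedFrobenioid_weak_piNat` (`ℤ`) and `nonempty_temperedFrobenioid_weakR_piNat` (`ℝ`), for all three
monoid types. [cite: MochizukiEtTh2009, Def 3.6 p.77] -/
theorem nonempty_temperedFrobenioid_weakQ_piNat :
    Nonempty (TemperedFrobenioid WeakPiNat.realifiedQ (Discrete PUnit.{1}) (treeCatVocab (Discrete PUnit.{1}) R S)) :=
  ⟨genuineTemperedFrobenioidQ R S⟩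

end WeakPiNat

end Literature.AnabelianGeometry.EtaleTheta

end
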